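import Summits.ResolutionOfSingularities.ResolutionOfSingularities.Theses.AbhyankarShadows
import Literature.AlgebraicGeometry.Resolution.ResolutionLU
import Literature.AlgebraicGeometry.Resolution.AffineDomainDimension
import Literature.AlgebraicGeometry.Resolution.LocalUniformizationClosedPoints
import Literature.AlgebraicGeometry.Resolution.LocalUniformizationAbhyankarPlaces

/-!
# Negative lemmas for crux `PatchingPerfect` (stmt-ResolutionOfSingularities-16089):
# load-bearing analysis of the ANTECEDENT (relative local uniformization over one perfect field)

The antecedent of `PatchingPerfect` at `(p, k)` is `RelLU_k`: for every finitely generated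
`K/k`, every valuation ring `O ∋ k` of `K` and every finitely generated `k`-subalgebra `R ⊆ O`,
some finitely generated `A` with `R ≤ A ⊆ O`, `Frac A = K`, `A` regular at the centre of `O`.
Each clause dropped in turn (standing disprover, cycle 1, `Cruxes/PatchingPerfect/Disproof.lean`
§2; every statement fieldwise and unconditional):

* (A1) `k ⊆ O` — REDUNDANT (`patchingPerfect_relLU_noConst_iff`);
* (A2) `IsFractionRing A K` — REDUNDANT (`patchingPerfect_relLU_noFrac_iff`);
* (A3) regularity at the centre — THE CONTENT: dropped, the antecedent is a theorem over every
  field (`patchingPerfect_relLU_noReg_holds`) and the crux collapses to weak resolution over all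
  perfect fields (`patchingPerfect_withoutReg_iff`) — verbatim the antecedent of
  `DescentPerfectToAll` (stmt-0549), no cheaper than the summit over perfect fields;
* (A4) `R.FG` — a TRAP: dropped, the antecedent is FALSE over every field
  (`patchingPerfect_not_relLU_noRFG`, witness `K = k(X)`, `O = K`, `R = K`, Zariski's lemma), so
  that variant of the crux holds vacuously (`patchingPerfect_withoutRFG_vacuous`);
* (A5) `(⊤ : IntermediateField k K).FG` — a TRAP: dropped, the antecedent is FALSE over every field
  (`patchingPerfect_not_relLU_noKFG`, witness `K = k(X₀, X₁, …)` of transcendence degree `ℵ₀`,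
  `O = K`, `R = ⊥`), so that variant holds vacuously (`patchingPerfect_withoutKFG_vacuous`);
* (A6) `PerfectField k` — consumed by no step of the engine (see `WhyItResists.lean`); what it
  buys is on the antecedent's side: over a perfect `k`, relative LU is EQUIVALENT to its hard core
  at ZERO-DIMENSIONAL NON-ABHYANKAR valuation rings (`patchingPerfect_relLU_iff_hard`: closed
  points of the Zariski–Riemann space suffice, tree `exists_minimal_valuationSubring_le` +
  `isRegularLocalRing_centre_of_le`; Abhyankar places are free over a perfect ground field,
  Knaf–Kuhlmann 2005 Thm. 1.1, tree `relLU_at_abhyankarPlace_of_perfectField`), hence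
  `patchingPerfect_iff_hard`. For route `AbhyankarShadows` this means its cruxes
  `SemivaluationShadows` / `ShadowsUniformize` are only ever needed at non-Abhyankar rational
  valuation rings — Teissier's own scope.
-/

noncomputable section

set_option linter.dupNamespace false

open CategoryTheory AlgebraicGeometry
open Literature.AlgebraicGeometry.Resolution
open Summit.ResolutionOfSingularities.ResolutionOfSingularities.Theses.AbhyankarShadows
  (PatchingPerfect DescentPerfectToAll)

namespace Summit.ResolutionOfSingularities.ResolutionOfSingularities.Theorems.PatchingPerfect.Negative

/-- **(A1) `k ⊆ O` is redundant in the antecedent**: any `k`-subalgebra `R ⊆ O` already contains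
the constants, so the antecedent stated for ALL valuation rings of `K` is equivalent.
[folklore] -/
theorem patchingPerfect_relLU_noConst_iff (k : Type) [Field k] :
    (∀ (K : Type) [Field K] [Algebra k K], (⊤ : IntermediateField k K).FG →
      ∀ O : ValuationSubring K, ∀ R : Subalgebra k K, R.FG →
        R.toSubring ≤ O.toSubring → ∃ (A : Subalgebra k K) (h : A.toSubring ≤ O.toSubring),
          R ≤ A ∧ A.FG ∧ IsFractionRing A K ∧ IsRegularLocalRing (Localization.AtPrime
            (Ideal.comap (Subring.inclusion h) (IsLocalRing.maximalIdeal O)))) ↔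
    (∀ (K : Type) [Field K] [Algebra k K], (⊤ : IntermediateField k K).FG →
      ∀ O : ValuationSubring K, (∀ c : k, algebraMap k K c ∈ O) → ∀ R : Subalgebra k K, R.FG →
        R.toSubring ≤ O.toSubring → ∃ (A : Subalgebra k K) (h : A.toSubring ≤ O.toSubring),
          R ≤ A ∧ A.FG ∧ IsFractionRing A K ∧ IsRegularLocalRing (Localization.AtPrime
            (Ideal.comap (Subring.inclusion h) (IsLocalRing.maximalIdeal O)))) :=
  ⟨fun h K _ _ hKfg O _ R hRfg hRO => h K hKfg O R hRfg hRO,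
    fun h K _ _ hKfg O R hRfg hRO => h K hKfg O (fun c => hRO (R.algebraMap_mem c)) R hRfg hRO⟩

/-- **(A2) `IsFractionRing A K` is redundant in the antecedent's conclusion**: enlarge `R` by an
affine model of `O` first (`exists_affineModel`); every `A` above it has fraction field `K`.
[folklore] -/
theorem patchingPerfect_relLU_noFrac_iff (k : Type) [Field k] :
    (∀ (K : Type) [Field K] [Algebra k K], (⊤ : IntermediateField k K).FG →
      ∀ O : ValuationSubring K, (∀ c : k, algebraMap k K c ∈ O) → ∀ R : Subalgebra k K, R.FG →
        R.toSubring ≤ O.toSubring → ∃ (A : Subalgebra k K) (h : A.toSubring ≤ O.toSubring),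
          R ≤ A ∧ A.FG ∧ IsRegularLocalRing (Localization.AtPrime
            (Ideal.comap (Subring.inclusion h) (IsLocalRing.maximalIdeal O)))) ↔
    (∀ (K : Type) [Field K] [Algebra k K], (⊤ : IntermediateField k K).FG →
      ∀ O : ValuationSubring K, (∀ c : k, algebraMap k K c ∈ O) → ∀ R : Subalgebra k K, R.FG →
        R.toSubring ≤ O.toSubring → ∃ (A : Subalgebra k K) (h : A.toSubring ≤ O.toSubring),
          R ≤ A ∧ A.FG ∧ IsFractionRing A K ∧ IsRegularLocalRing (Localization.AtPrime
            (Ideal.comap (Subring.inclusion h) (IsLocalRing.maximalIdeal O)))) := by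
  refine ⟨fun h K _ _ hKfg O hO R hRfg hRO => ?_,
    fun h K _ _ hKfg O hO R hRfg hRO => ?_⟩
  · obtain ⟨A₀, hA₀O, hA₀fg, hA₀fr⟩ := exists_affineModel k K hKfg O hO
    have hR'O : (R ⊔ A₀).toSubring ≤ O.toSubring := by
      let Oalg : Subalgebra k K := { O.toSubring with algebraMap_mem' := hO }
      change R ⊔ A₀ ≤ Oalg
      exact sup_le (fun x hx => hRO hx) (fun x hx => hA₀O hx)
    obtain ⟨A, hA, hle, hAfg, hreg⟩ := h K hKfg O hO (R ⊔ A₀) (hRfg.sup hA₀fg) hR'O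
    exact ⟨A, hA, le_sup_left.trans hle, hAfg,
      isFractionRing_of_le (le_sup_right.trans hle) hA₀fr, hreg⟩
  · obtain ⟨A, hA, hle, hAfg, -, hreg⟩ := h K hKfg O hO R hRfg hRO
    exact ⟨A, hA, hle, hAfg, hreg⟩

/-- **(A3) Regularity at the centre is THE content of the antecedent**: with it dropped, the
antecedent is a theorem over every field (affine models exist). [folklore] -/
theorem patchingPerfect_relLU_noReg_holds (k : Type) [Field k] :
    (∀ (K : Type) [Field K] [Algebra k K], (⊤ : IntermediateField k K).FG →
      ∀ O : ValuationSubring K, (∀ c : k, algebraMap k K c ∈ O) → ∀ R : Subalgebra k K, R.FG →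
        R.toSubring ≤ O.toSubring → ∃ (A : Subalgebra k K) (_ : A.toSubring ≤ O.toSubring),
          R ≤ A ∧ A.FG ∧ IsFractionRing A K) := by
  intro K _ _ hKfg O hO R hRfg hRO
  obtain ⟨A₀, hA₀O, hA₀fg, hA₀fr⟩ := exists_affineModel k K hKfg O hO
  have hR'O : (R ⊔ A₀).toSubring ≤ O.toSubring := by
    let Oalg : Subalgebra k K := { O.toSubring with algebraMap_mem' := hO }
    change R ⊔ A₀ ≤ Oalg
    exact sup_le (fun x hx => hRO hx) (fun x hx => hA₀O hx)
  exact ⟨R ⊔ A₀, hR'O, le_sup_left, hRfg.sup hA₀fg, isFractionRing_of_le le_sup_right hA₀fr⟩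

/-- **(A3) Dropping regularity at the centre collapses the crux to weak resolution over ALL
perfect fields** — verbatim the antecedent of `DescentPerfectToAll` (stmt-0549), i.e. the summit
over perfect fields: a strictly harder statement, not a simplification. [folklore] -/
theorem patchingPerfect_withoutReg_iff :
    (∀ p : ℕ, p.Prime → ∀ (k : Type) [Field k] [CharP k p] [PerfectField k],
      (∀ (K : Type) [Field K] [Algebra k K], (⊤ : IntermediateField k K).FG →
      ∀ O : ValuationSubring K, (∀ c : k, algebraMap k K c ∈ O) → ∀ R : Subalgebra k K, R.FG →
        R.toSubring ≤ O.toSubring → ∃ (A : Subalgebra k K) (_ : A.toSubring ≤ O.toSubring),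
          R ≤ A ∧ A.FG ∧ IsFractionRing A K) →
      (∀ (X : Scheme.{0}) (f : X ⟶ Spec (.of k)), IsSeparated f → LocallyOfFiniteType f →
      QuasiCompact f → IsReduced X → Scheme.HasResolution X)) ↔
    ∀ p : ℕ, p.Prime → ∀ (k : Type) [Field k] [CharP k p] [PerfectField k],
      (∀ (X : Scheme.{0}) (f : X ⟶ Spec (.of k)), IsSeparated f → LocallyOfFiniteType f →
      QuasiCompact f → IsReduced X → Scheme.HasResolution X) :=
  ⟨fun h p hp k _ _ _ => h p hp k (patchingPerfect_relLU_noReg_holds k),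
    fun h p hp k _ _ _ _ => h p hp k⟩

/-- (A3, cross-check) the collapsed statement is literally the antecedent of
`DescentPerfectToAll` at each prime (definitional). [folklore] -/
theorem descentPerfectToAll_iff :
    DescentPerfectToAll ↔ ∀ p : ℕ, p.Prime →
      (∀ (k : Type) [Field k] [CharP k p] [PerfectField k],
      (∀ (X : Scheme.{0}) (f : X ⟶ Spec (.of k)), IsSeparated f → LocallyOfFiniteType f →
      QuasiCompact f → IsReduced X → Scheme.HasResolution X)) →
        ResolutionInChar.{0} p :=
  Iff.rfl

/-- **(A4) `R.FG` is load-bearing — dropped, the antecedent is FALSE over EVERY field** (witness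
`K = k(X)`, `O = K`, `R = K`: a finitely generated `A ⊇ K` makes `k(X)` a finitely generated
`k`-algebra, finite over `k` by Zariski's lemma, contradicting the transcendence of `X`; the
sibling crux `PatchingRel` has the `𝔽_p` instance, `PatchingRel.Negative.not_lurel_without_rfg`).
[folklore] -/
theorem patchingPerfect_not_relLU_noRFG (k : Type) [Field k] :
    ¬ (∀ (K : Type) [Field K] [Algebra k K], (⊤ : IntermediateField k K).FG →
      ∀ O : ValuationSubring K, (∀ c : k, algebraMap k K c ∈ O) → ∀ R : Subalgebra k K,
        R.toSubring ≤ O.toSubring → ∃ (A : Subalgebra k K) (h : A.toSubring ≤ O.toSubring),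
          R ≤ A ∧ A.FG ∧ IsFractionRing A K ∧ IsRegularLocalRing (Localization.AtPrime
            (Ideal.comap (Subring.inclusion h) (IsLocalRing.maximalIdeal O)))) := by
  intro h
  obtain ⟨A, -, hle, hAfg, -, -⟩ := h (FractionRing (Polynomial k))
    (IntermediateField.fg_top_iff.mpr
      (Algebra.EssFiniteType.comp k (Polynomial k) _))
    ⊤ (fun _ => ValuationSubring.mem_top _) ⊤ (fun _ _ => ValuationSubring.mem_top _)
  have htop : (⊤ : Subalgebra k (FractionRing (Polynomial k))).FG := by
    rwa [← eq_top_iff.mpr hle]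
  haveI : Algebra.FiniteType k (FractionRing (Polynomial k)) := ⟨htop⟩
  haveI : Module.Finite k (FractionRing (Polynomial k)) :=
    finite_of_finite_type_of_isJacobsonRing k _
  have hT : Transcendental k
      (algebraMap (Polynomial k) (FractionRing (Polynomial k)) Polynomial.X) :=
    (transcendental_algebraMap_iff (IsFractionRing.injective (Polynomial k) _)).mpr
      (Polynomial.transcendental_X k)
  exact hT (Algebra.IsAlgebraic.isAlgebraic _)

/-- **(A4) … so the crux with `R.FG` dropped from its antecedent holds VACUOUSLY** — a trap, not
information about resolution. [folklore] -/
theorem patchingPerfect_withoutRFG_vacuous :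
    ∀ p : ℕ, p.Prime → ∀ (k : Type) [Field k] [CharP k p] [PerfectField k],
      (∀ (K : Type) [Field K] [Algebra k K], (⊤ : IntermediateField k K).FG →
      ∀ O : ValuationSubring K, (∀ c : k, algebraMap k K c ∈ O) → ∀ R : Subalgebra k K,
        R.toSubring ≤ O.toSubring → ∃ (A : Subalgebra k K) (h : A.toSubring ≤ O.toSubring),
          R ≤ A ∧ A.FG ∧ IsFractionRing A K ∧ IsRegularLocalRing (Localization.AtPrime
            (Ideal.comap (Subring.inclusion h) (IsLocalRing.maximalIdeal O)))) →
      (∀ (X : Scheme.{0}) (f : X ⟶ Spec (.of k)), IsSeparated f → LocallyOfFiniteType f →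
      QuasiCompact f → IsReduced X → Scheme.HasResolution X) :=
  fun _ _ k _ _ _ h => absurd h (patchingPerfect_not_relLU_noRFG k)

/-- No finitely generated `k`-subalgebra of `k(X₀, X₁, …)` has it as fraction field: the
transcendence degree of `k(X₀, X₁, …)` is `ℵ₀` (`MvPolynomial.trdeg_of_isDomain`,
`trdeg_add_eq`), that of the fraction field of a finitely generated domain is finite (tree
`exists_ringKrullDim_eq_and_trdeg_eq`, `trdeg_eq_trdeg_of_isFractionRing`). [folklore] -/
theorem not_exists_fg_isFractionRing_mvPolynomial (k : Type) [Field k] :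
    ¬ ∃ A : Subalgebra k (FractionRing (MvPolynomial ℕ k)),
      A.FG ∧ IsFractionRing A (FractionRing (MvPolynomial ℕ k)) := by
  rintro ⟨A, hfg, hfr⟩
  haveI : Algebra.FiniteType k A := A.fg_iff_finiteType.mp hfg
  obtain ⟨n, -, htr⟩ := exists_ringKrullDim_eq_and_trdeg_eq k A
  have h1 : Algebra.trdeg k (FractionRing (MvPolynomial ℕ k)) = n := by
    rw [trdeg_eq_trdeg_of_isFractionRing A, htr]
  have h2 : Algebra.trdeg k (FractionRing (MvPolynomial ℕ k)) = Cardinal.aleph0 := by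
    haveI : Algebra.IsAlgebraic (MvPolynomial ℕ k) (FractionRing (MvPolynomial ℕ k)) :=
      IsLocalization.isAlgebraic (FractionRing (MvPolynomial ℕ k))
        (nonZeroDivisors (MvPolynomial ℕ k))
    rw [← trdeg_add_eq k (MvPolynomial ℕ k) (A := FractionRing (MvPolynomial ℕ k)),
      trdeg_eq_zero (R := MvPolynomial ℕ k) (A := FractionRing (MvPolynomial ℕ k)), add_zero,
      MvPolynomial.trdeg_of_isDomain, Cardinal.mk_nat]
    simp
  rw [h1] at h2
  exact (Cardinal.natCast_lt_aleph0 (n := n)).ne h2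

/-- **(A5) `(⊤ : IntermediateField k K).FG` is load-bearing — dropped, the antecedent is FALSE
over EVERY field** (witness `K = k(X₀, X₁, …)`, `O = K`, `R = ⊥`; the sibling's tree lemma
`not_lurel_without_fg` is the `𝔽_p`, `K = 𝔽_p^alg` instance). [folklore] -/
theorem patchingPerfect_not_relLU_noKFG (k : Type) [Field k] :
    ¬ (∀ (K : Type) [Field K] [Algebra k K],
      ∀ O : ValuationSubring K, (∀ c : k, algebraMap k K c ∈ O) → ∀ R : Subalgebra k K,
        R.FG → R.toSubring ≤ O.toSubring →
          ∃ (A : Subalgebra k K) (h : A.toSubring ≤ O.toSubring),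
          R ≤ A ∧ A.FG ∧ IsFractionRing A K ∧ IsRegularLocalRing (Localization.AtPrime
            (Ideal.comap (Subring.inclusion h) (IsLocalRing.maximalIdeal O)))) := by
  intro h
  obtain ⟨A, -, -, hfg, hfr, -⟩ := h (FractionRing (MvPolynomial ℕ k)) ⊤
    (fun c => ValuationSubring.mem_top _) ⊥ Subalgebra.fg_bot (fun x _ => trivial)
  exact not_exists_fg_isFractionRing_mvPolynomial k ⟨A, hfg, hfr⟩

/-- **(A5) … so the crux with finite generation of `K/k` dropped from its antecedent holds
VACUOUSLY** — a trap. [folklore] -/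
theorem patchingPerfect_withoutKFG_vacuous :
    ∀ p : ℕ, p.Prime → ∀ (k : Type) [Field k] [CharP k p] [PerfectField k],
      (∀ (K : Type) [Field K] [Algebra k K],
      ∀ O : ValuationSubring K, (∀ c : k, algebraMap k K c ∈ O) → ∀ R : Subalgebra k K,
        R.FG → R.toSubring ≤ O.toSubring →
          ∃ (A : Subalgebra k K) (h : A.toSubring ≤ O.toSubring),
          R ≤ A ∧ A.FG ∧ IsFractionRing A K ∧ IsRegularLocalRing (Localization.AtPrime
            (Ideal.comap (Subring.inclusion h) (IsLocalRing.maximalIdeal O)))) →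
      (∀ (X : Scheme.{0}) (f : X ⟶ Spec (.of k)), IsSeparated f → LocallyOfFiniteType f →
      QuasiCompact f → IsReduced X → Scheme.HasResolution X) :=
  fun _ _ k _ _ _ h => absurd h (patchingPerfect_not_relLU_noKFG k)

/-- **(A6) Over a PERFECT field, relative LU is equivalent to its hard core at zero-dimensional
non-Abhyankar valuation rings** (closed points of the Zariski–Riemann space that are not
Abhyankar places of `K | k`): refine `O` to a valuation ring minimal over `R`, which is
zero-dimensional; if it is an Abhyankar place it is uniformizable for free over a perfect ground
field (Knaf–Kuhlmann 2005, Thm. 1.1); regularity at its centre descends to the coarsening `O`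
(Serre). This is the one place perfectness of `k` does work for the crux.
[cite: KnafKuhlmann2005, Thm. 1.1 and Cor. 2.2] -/
theorem patchingPerfect_relLU_iff_hard (k : Type) [Field k] [PerfectField k] :
    (∀ (K : Type) [Field K] [Algebra k K], (⊤ : IntermediateField k K).FG →
      ∀ O : ValuationSubring K, (∀ c : k, algebraMap k K c ∈ O) → ∀ R : Subalgebra k K, R.FG →
        R.toSubring ≤ O.toSubring → ∃ (A : Subalgebra k K) (h : A.toSubring ≤ O.toSubring),
          R ≤ A ∧ A.FG ∧ IsFractionRing A K ∧ IsRegularLocalRing (Localization.AtPrime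
            (Ideal.comap (Subring.inclusion h) (IsLocalRing.maximalIdeal O)))) ↔
    (∀ (K : Type) [Field K] [Algebra k K], (⊤ : IntermediateField k K).FG →
      ∀ O : ValuationSubring K, (∀ c : k, algebraMap k K c ∈ O) →
        (∀ x ∈ O, ∃ f : Polynomial k, f ≠ 0 ∧ Polynomial.aeval x f ∈ O.nonunits) →
        ¬ IsAbhyankarPlace O (algebraMap k K).fieldRange ⊤ →
        ∀ R : Subalgebra k K, R.FG →
        R.toSubring ≤ O.toSubring → ∃ (A : Subalgebra k K) (h : A.toSubring ≤ O.toSubring),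
          R ≤ A ∧ A.FG ∧ IsFractionRing A K ∧ IsRegularLocalRing (Localization.AtPrime
            (Ideal.comap (Subring.inclusion h) (IsLocalRing.maximalIdeal O)))) := by
  refine ⟨fun h K _ _ hKfg O hO _ _ R hRfg hRO => h K hKfg O hO R hRfg hRO,
    fun h K _ _ hKfg O hO R hRfg hRO => ?_⟩
  obtain ⟨O', hO'O, hRO', hmin⟩ := exists_minimal_valuationSubring_le R O hRO
  have hO' : ∀ c : k, algebraMap k K c ∈ O' := fun c => hRO' (R.algebraMap_mem c)
  have hzd := exists_aeval_mem_nonunits_of_minimal R hRfg O' hRO' hmin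
  suffices hLU' : ∃ (A : Subalgebra k K) (h : A.toSubring ≤ O'.toSubring),
      R ≤ A ∧ A.FG ∧ IsFractionRing A K ∧ IsRegularLocalRing (Localization.AtPrime
        (Ideal.comap (Subring.inclusion h) (IsLocalRing.maximalIdeal O'))) by
    obtain ⟨A, hA, hRA, hAfg, hfr, hreg⟩ := hLU'
    exact ⟨A, fun x hx => hO'O (hA hx), hRA, hAfg, hfr,
      isRegularLocalRing_centre_of_le A hO'O hA _ hreg⟩
  by_cases hAbh : IsAbhyankarPlace O' (algebraMap k K).fieldRange ⊤
  · exact relLU_at_abhyankarPlace_of_perfectField hKfg O' hO' hAbh R hRfg hRO'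
  · exact h K hKfg O' hO' hzd hAbh R hRfg hRO'

/-- **(A6) Hence the crux is equivalent to itself with the antecedent cut down to the hard core**
(zero-dimensional non-Abhyankar valuation rings), perfectness used exactly once. [folklore] -/
theorem patchingPerfect_iff_hard :
    PatchingPerfect ↔ ∀ p : ℕ, p.Prime → ∀ (k : Type) [Field k] [CharP k p] [PerfectField k],
      (∀ (K : Type) [Field K] [Algebra k K], (⊤ : IntermediateField k K).FG →
      ∀ O : ValuationSubring K, (∀ c : k, algebraMap k K c ∈ O) →
        (∀ x ∈ O, ∃ f : Polynomial k, f ≠ 0 ∧ Polynomial.aeval x f ∈ O.nonunits) →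
        ¬ IsAbhyankarPlace O (algebraMap k K).fieldRange ⊤ →
        ∀ R : Subalgebra k K, R.FG →
        R.toSubring ≤ O.toSubring → ∃ (A : Subalgebra k K) (h : A.toSubring ≤ O.toSubring),
          R ≤ A ∧ A.FG ∧ IsFractionRing A K ∧ IsRegularLocalRing (Localization.AtPrime
            (Ideal.comap (Subring.inclusion h) (IsLocalRing.maximalIdeal O)))) →
      (∀ (X : Scheme.{0}) (f : X ⟶ Spec (.of k)), IsSeparated f → LocallyOfFiniteType f →
      QuasiCompact f → IsReduced X → Scheme.HasResolution X) :=
  ⟨fun h p hp k _ _ _ hLU => h p hp k ((patchingPerfect_relLU_iff_hard k).mpr hLU),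
    fun h p hp k _ _ _ hLU => h p hp k ((patchingPerfect_relLU_iff_hard k).mp hLU)⟩

end Summit.ResolutionOfSingularities.ResolutionOfSingularities.Theorems.PatchingPerfect.Negative

end
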